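import Summits.BirchSwinnertonDyer.BirchSwinnertonDyer.Theorems.PrintCf2SplitBadTwoF3LevelLift
import Summits.BirchSwinnertonDyer.BirchSwinnertonDyer.Theorems.PrintCf2SplitBadTwoKummerBranchInputs
import Summits.BirchSwinnertonDyer.BirchSwinnertonDyer.Theorems.PrintCf2SplitBadTwoKummerStrictAtV
import Summits.BirchSwinnertonDyer.BirchSwinnertonDyer.Theorems.PrintCf2SplitBadTwoKummerLineOfGenerator
import Literature.NumberTheory.EllipticCurves.KummerMap
import Summits.BirchSwinnertonDyer.BirchSwinnertonDyer.Theorems.PrintCf2SplitBadTwoRestrictedSelmerEigenProjector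
import Summits.BirchSwinnertonDyer.BirchSwinnertonDyer.Theorems.PrintCf2SplitBadTwoCMPrimaryStructure
import HarnessLib

/-!
# Crux `PrintCf2.SplitBadTwoRankOneOfFacts` (stmt-BirchSwinnertonDyer-20368), road α v10.3, S3c input (F3) — the κ-BRIDGE between X11b's
# level Kummer map and Agboola's, and the PINNING AT `v` FOR LIFTED POINT CLASSES ((PIN)(b) of p680684) from -w3 g9's `hH1_holds`

Cell `bsd-print-cf2`, EXTRA WIDTH seat `bsd-line-cf2-p1-w8` g3 (prover-bsd-line-cf2-p1-w8-g3-0); `--supports stmt-BirchSwinnertonDyer-20368`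
(helper, Theses-free). HONEST FRAMING: nothing here closes the crux or a registered stub; BSD is not proved by any of this; no summit
statement is proved by this seat. No definition, no named fact, no `sorry`, no kit. beyond-print theorem: no.

WHAT.
* §1 **`toDiscreteH1_map_primaryInclusion_kummerMapTorsion`** — THE κ-BRIDGE: `H¹(ι_N)(κ_N^{X11b}(Q)) = κ_N^{lev}(Q)` in `H¹(Γ_K, E[p^∞])`
  (X11b/Literature `kummerMapTorsion` at level `p^N` pushed along `primaryInclusion`, versus the tree's `kummerMapLevel`; both are the class of
  `σ ↦ σR − R` for a root `p^N R = Q`).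
* §2 **`resOfLe_levelLift_kummerMapTorsion_eq_zero_of_comap_le`** (generic `V/K`): if the W*-classes whose `ι_*`-image is a `p^∞`-Kummer class die on
  `D_v` (the shape of -w3 g9's `CMPrimes.hH1_holds`) and `ι_* e_* κ^{lev}_N(Q)` is again a Kummer class (the shape of -w3 g9's (S)
  `resH1Hom_subtype_proj_kummerMapLevel`), then the LEVEL LIFT `Φ_N(κ_N^{X11b}(Q)) = res_{Γ_K→⊤}(e_* H¹(ι_N) κ_N(Q))` dies on `D_v`.
* §3 **`hPINb_holds`** — on every S3c frame, for every equivariant projector `e` onto `W*` killing `W*′`, every level `N` and every `Q ∈ E(K)`: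
  `res_{D_v} Φ_N(κ_N(Q)) = 0` — conjunct (b) of the displayed input (PIN) of p680684 `hcounts_of_pointIndex_of_pinning_of_finiteSha`,
  HYPOTHESIS-FREE (hH1_holds + (S) + the level data `N₁ ≡ r`, `N₂ ≡ 1 − r`, `w (N₁ − N₂) ≡ 1`).
presearch: Kummer maps at finite level vs `p^∞` (Greenberg LNM 1716 §2, Silverman VIII §2) — tree theorems in two currencies; no new fact.

References: [GreenbergLNM1716] §2 (p. 62); [SilvermanAEC2009] VIII §2; [Rubin1999] §2; [Agboola2007] §6.
-/

noncomputable section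

open scoped Classical
open scoped TensorProduct

set_option linter.dupNamespace false
set_option autoImplicit false

open CategoryTheory Function Field NumberField IsDedekindDomain WeierstrassCurve
open Literature.NumberTheory.EllipticCurves Literature.NumberTheory.EllipticCurves.GreenbergSelmer
open Literature.NumberTheory.EllipticCurves.Agboola2007
open Literature.NumberTheory.EllipticCurves.ResKernel
open Literature.NumberTheory.GaloisRepresentations
open scoped ContRepresentation
open Summit.BirchSwinnertonDyer.Rank1Residual.X11b
open Summit.BirchSwinnertonDyer.Rank1Residual.X11b.LocBridge
open Summit.BirchSwinnertonDyer.Rank1Residual.X11b.Levels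
open Summit.BirchSwinnertonDyer.BirchSwinnertonDyer.Theorems.PrintCf2
open Summit.BirchSwinnertonDyer.BirchSwinnertonDyer.Theorems.PrintCf2.RestrictedSelmerPair

namespace Summit.BirchSwinnertonDyer.BirchSwinnertonDyer.Theorems.PrintCf2.SelmerLocImage

/-! ## §1. The κ-bridge -/

section Bridge

variable {K : Type} [Field K] (V : WeierstrassCurve K) [V.IsElliptic] (p : ℕ) [hp : Fact p.Prime] (N : ℕ)

/-- **THE κ-BRIDGE: `H¹(ι_N)(κ_N^{X11b}(Q)) = κ_N^{lev}(Q)`.** The X11b/Literature level-`p^N` Kummer class `kummerMapTorsion V (p^N) _ Q ∈ H¹(K, E[p^N])`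
pushed to `H¹(K, E[p^∞])` along `primaryInclusion` (and read in the `discreteH1` model, `toDiscreteH1 = id`) IS the tree's `kummerMapLevel p _ N Q`:
both are the class of the cocycle `σ ↦ σR − R` for one root `p^N R = Q` (`kummerMapTorsionFun_eq`, `kummerMapLevel_eq_kummerClass`).
[cite: SilvermanAEC2009, VIII §2 (the Kummer pairing)] [cite: GreenbergLNM1716, §2 (p. 62)] -/
theorem toDiscreteH1_map_primaryInclusion_kummerMapTorsion (hdiv : V.zsmul_geomPoints_surjective) (Q : V.toAffine.Point) :
    toDiscreteH1 (isOpen_stabilizer_geomPrimaryTorsion V p)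
        (galoisCohomology.map (primaryInclusion V p N) 1
          (kummerMapTorsion V ((p ^ N : ℕ) : ℤ) (hdiv (Int.natCast_ne_zero.mpr (NeZero.ne (p ^ N)))) Q)) =
      V.kummerMapLevel p hdiv N Q := by
  haveI : NeZero (p ^ N) := ⟨pow_ne_zero N hp.out.ne_zero⟩
  set R := V.kummerRoot p hdiv N Q with hRdef
  have hR : p ^ N • R = toGeomPoints V Q := V.nsmul_kummerRoot p hdiv N Q
  have hRz : ((p ^ N : ℕ) : ℤ) • R = toGeomPoints V Q := by rw [natCast_zsmul, hR]
  rw [V.kummerMapLevel_eq_kummerClass p hdiv N Q R hR, kummerMapTorsion_apply,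
    kummerMapTorsionFun_eq V ((p ^ N : ℕ) : ℤ) _ Q R hRz, toDiscreteH1_apply]
  unfold kummerClassTorsion WeierstrassCurve.kummerClass
  erw [galoisCohomology.map_one_oneCocycleClass]
  congr 1

end Bridge

/-! ## §2. Pinning of lifted point classes from an `hH1`-shaped vanishing -/

section Pinning

variable {K : Type} [Field K] [NumberField K] (V : WeierstrassCurve K) [V.IsElliptic] (p : ℕ) [hp : Fact p.Prime]
  (π : V.endRing) (r : ℤ_[p]) (N : ℕ)
  (e : V.geomPrimaryTorsion p →+ ↥(V.endEigenPrimaryTorsion p π r))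
  (he : ∀ (σ : absoluteGaloisGroup K) (x : V.geomPrimaryTorsion p), e (σ • x) = σ • e x)

/-- **The level lift of a global Kummer class dies on `D_v`** whenever (i) every `W*`-class over `⊤` whose `ι_*`-image is (the restriction of) a
`p^∞`-Kummer class dies on `D_v` (the conclusion shape of -w3 g9's `CMPrimes.hH1_holds`), and (ii) `ι_* e_* κ^{lev}_N(Q)` is itself a level-`N`
Kummer class (the shape of -w3 g9's (S) `resH1Hom_subtype_proj_kummerMapLevel`). The lift is -w5 g3's `Φ_N` (p677230) applied to the X11b
Kummer class `κ_N(Q)` (κ-bridge §1). [cite: GreenbergLNM1716, §2 (p. 62)] [cite: Rubin1999, §2] -/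
theorem resOfLe_levelLift_kummerMapTorsion_eq_zero_of_comap_le (v : HeightOneSpectrum (𝓞 K))
    (hH1 : (((V.kummerMapPInfty p V.zsmul_geomPoints_surjective_holds).range).map
          (resSubgroup ⊤ (V.geomPrimaryTorsion p))).comap
        (resH1Hom (ContinuousMonoidHom.id _) (V.endEigenPrimaryTorsion p π r).subtype (fun _ _ ↦ rfl)) ≤
      (resOfLe ↥(V.endEigenPrimaryTorsion p π r) (inf_le_left : (⊤ : Subgroup (absoluteGaloisGroup K)) ⊓ decomp v ≤ ⊤)).ker)
    (Q : V.toAffine.Point)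
    (hS : ∃ Q' : V.toAffine.Point,
      resH1Hom (ContinuousMonoidHom.id (absoluteGaloisGroup K)) (V.endEigenPrimaryTorsion p π r).subtype (fun _ _ ↦ rfl)
          (resH1Hom (ContinuousMonoidHom.id (absoluteGaloisGroup K)) e (fun σ x ↦ he σ x)
            (V.kummerMapLevel p V.zsmul_geomPoints_surjective_holds N Q)) =
        V.kummerMapLevel p V.zsmul_geomPoints_surjective_holds N Q') :
    resOfLe ↥(V.endEigenPrimaryTorsion p π r) (inf_le_left : (⊤ : Subgroup (absoluteGaloisGroup K)) ⊓ decomp v ≤ ⊤)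
      (resH1Hom (Literature.NumberTheory.EllipticCurves.subgroupIncl (⊤ : Subgroup (absoluteGaloisGroup K)))
        (AddMonoidHom.id ↥(V.endEigenPrimaryTorsion p π r)) (fun _ _ ↦ rfl)
        (resH1Hom (ContinuousMonoidHom.id (absoluteGaloisGroup K)) e (fun σ m ↦ he σ m)
          (toDiscreteH1 (isOpen_stabilizer_geomPrimaryTorsion V p) (galoisCohomology.map (primaryInclusion V p N) 1
            (kummerMapTorsion V ((p ^ N : ℕ) : ℤ) (V.zsmul_geomPoints_surjective_holds (NeZero.ne _)) Q))))) = 0 := by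
  rw [toDiscreteH1_map_primaryInclusion_kummerMapTorsion V p N V.zsmul_geomPoints_surjective_holds Q]
  obtain ⟨Q', hQ'⟩ := hS
  refine (AddMonoidHom.mem_ker).mp (hH1 ?_)
  rw [AddSubgroup.mem_comap]
  -- `ι_* res_⊤ (e_* κ) = res_⊤ (ι_* e_* κ) = res_⊤ κ_N(Q') = res_⊤ κ^∞(Q' ⊗ e_N)`
  have hcomm := resSubgroup_resH1Hom_subtype V p π r (⊤ : Subgroup (absoluteGaloisGroup K))
    (resH1Hom (ContinuousMonoidHom.id (absoluteGaloisGroup K)) e (fun σ x ↦ he σ x)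
      (V.kummerMapLevel p V.zsmul_geomPoints_surjective_holds N Q))
  change resH1Hom (ContinuousMonoidHom.id _) (V.endEigenPrimaryTorsion p π r).subtype (fun _ _ ↦ rfl)
      (resSubgroup ⊤ ↥(V.endEigenPrimaryTorsion p π r)
        (resH1Hom (ContinuousMonoidHom.id (absoluteGaloisGroup K)) e (fun σ x ↦ he σ x)
          (V.kummerMapLevel p V.zsmul_geomPoints_surjective_holds N Q))) ∈ _
  rw [← hcomm, hQ', ← V.kummerMapPInfty_tmul_prufGen p V.zsmul_geomPoints_surjective_holds Q' N]
  exact ⟨_, ⟨_, rfl⟩, rfl⟩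

end Pinning

/-! ## §3. The S3c frame: (PIN)(b) holds -/

section Frame

/-- **(PIN)(b) HOLDS on every S3c frame**: for every equivariant projector `e` onto `W* = E[𝔮_r^∞]` killing `W*′`, every level `N` and every
`Q ∈ E(K)`, the level lift `Φ_N(κ_N(Q))` dies on `D_v` — from -w3 g9's hypothesis-free `CMPrimes.hH1_holds` (global point classes are strict at
`v` on the `W*`-side) via §2, with (S) `resH1Hom_subtype_proj_kummerMapLevel` (-w3 g9) and the level data `N₁ ≡ r`, `N₂ ≡ 1 − r`,
`w (N₁ − N₂) ≡ 1 (mod 2^N)` (`exists_proj_levelData`). In particular the second conjunct of the displayed input (PIN) of p680684 holds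
(take `Q := M • P_K`). [cite: Rubin1999, §2–§3] [cite: GreenbergLNM1716, §2] -/
theorem hPINb_holds : ∀ (d : ℤ), d ≠ 0 → Squarefree d → d % 4 ≠ 1 →
      ∀ (W : WeierstrassCurve ℚ) [W.IsElliptic] [W.IsGloballyMinimal] (C : WeierstrassCurve.VariableChange ℚ),
        C • W = cm7.quadraticTwist (d : ℚ) → W.analyticRank = 1 →
      ∀ (K : Type) [Field K] [NumberField K], IsImaginaryQuadratic K →
      ∀ (v vbar : HeightOneSpectrum (𝓞 K)),
        ((2 : ℕ) : 𝓞 K) ∈ v.asIdeal → ((2 : ℕ) : 𝓞 K) ∈ vbar.asIdeal → vbar ≠ v →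
      ∀ (π : (W.baseChange K).endRing), (π : AddMonoid.End (W.baseChange K).geomPoints) * π = π - 2 →
      ∀ (r : ℤ_[2]), r * r = r - 2 →
        (∀ τ ∈ GreenbergSelmer.inertia v, ∀ x : ↥((W.baseChange K).endEigenPrimaryTorsion 2 π r), τ • x = x ∨ τ • x = -x) →
      ∀ (P : W.toAffine.Point) (c₀ : ℕ) (ℓ : ℤ),
        ¬ IsOfFinAddOrder P →
        (∀ R : W.toAffine.Point, ∃ (k : ℤ) (T : W.toAffine.Point), IsOfFinAddOrder T ∧ R = k • P + T) →
        c₀ ≠ 0 → (W.baseChange ℚ_[2]).IsInReductionKernel (c₀ • W.toPadicPoint 2 P) →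
        ‖(W.baseChange ℚ_[2]).padicLogPoint (c₀ • W.toPadicPoint 2 P) / (c₀ : ℚ_[2])‖ = (2 : ℝ) ^ (-ℓ) →
      Finite (restrictedSelmerBase ↥((W.baseChange K).endEigenPrimaryTorsion 2 π r) 2 vbar) →
      ∀ (e : (W.baseChange K).geomPrimaryTorsion 2 →+ ↥((W.baseChange K).endEigenPrimaryTorsion 2 π r))
        (he₁ : ∀ x : ↥((W.baseChange K).endEigenPrimaryTorsion 2 π r), e x = x)
        (he0 : ∀ x ∈ (W.baseChange K).endEigenPrimaryTorsion 2 π (1 - r), e x = 0)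
        (he : ∀ (σ : absoluteGaloisGroup K) (x : (W.baseChange K).geomPrimaryTorsion 2), e (σ • x) = σ • e x)
        (N : ℕ) (Q : (W.baseChange K).toAffine.Point),
        resOfLe ↥((W.baseChange K).endEigenPrimaryTorsion 2 π r) (inf_le_left : (⊤ : Subgroup (absoluteGaloisGroup K)) ⊓ decomp v ≤ ⊤)
          (resH1Hom (Literature.NumberTheory.EllipticCurves.subgroupIncl (⊤ : Subgroup (absoluteGaloisGroup K)))
            (AddMonoidHom.id ↥((W.baseChange K).endEigenPrimaryTorsion 2 π r)) (fun _ _ ↦ rfl)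
            (resH1Hom (ContinuousMonoidHom.id (absoluteGaloisGroup K)) e (fun σ m ↦ he σ m)
              (toDiscreteH1 (isOpen_stabilizer_geomPrimaryTorsion (W.baseChange K) 2)
                (galoisCohomology.map (primaryInclusion (W.baseChange K) 2 N) 1
                  (kummerMapTorsion (W.baseChange K) ((2 ^ N : ℕ) : ℤ) ((W.baseChange K).zsmul_geomPoints_surjective_holds (NeZero.ne _))
                    Q))))) = 0 := by
  intro d hd0 hsq hd4 W _ _ C hC hrk K _ _ hK v vbar hv hvbar hne π hrel r hr hpinI P c₀ ℓ hP hgen hc₀ hker hlog hfin e he₁ he0 he N Q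
  haveI : Fact (Nat.Prime 2) := ⟨Nat.prime_two⟩
  have hj : W.j = -3375 := AdditiveAtSeven.j_eq_of_smul_eq_cm7Twist hd0 W C hC
  obtain ⟨θ, hθ⟩ := exists_sq_eq_neg_seven_of_cmEndo_mem_endRing W K hj π hrel
  obtain ⟨-, hsup, -⟩ := CMPrimes.endEigenPrimaryTorsion_two_structure W hj K hθ π hrel hr
  -- the complementary projector at the conjugate root `1 - r` and `e + e' = 1`
  have hr' : (1 - r) * (1 - r) = (1 - r) - 2 := by linear_combination hr
  obtain ⟨e', he'₁, he'0, -, -⟩ := exists_eigenProjector_two W hj K hθ π hrel hr'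
  have hsum : ∀ x, (e x : (W.baseChange K).geomPrimaryTorsion 2) + (e' x : (W.baseChange K).geomPrimaryTorsion 2) = x := by
    intro x
    have hx : x ∈ (W.baseChange K).endEigenPrimaryTorsion 2 π r ⊔ (W.baseChange K).endEigenPrimaryTorsion 2 π (1 - r) :=
      hsup ▸ AddSubgroup.mem_top x
    obtain ⟨y, hy, y', hy', rfl⟩ := AddSubgroup.mem_sup.mp hx
    have hy2 : y ∈ (W.baseChange K).endEigenPrimaryTorsion 2 π (1 - (1 - r)) := by
      rw [sub_sub_cancel]; exact hy
    rw [map_add, map_add, he0 y' hy', he'0 y hy2, add_zero, zero_add,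
      show (e y : (W.baseChange K).geomPrimaryTorsion 2) = y from congrArg Subtype.val (he₁ ⟨y, hy⟩),
      show (e' y' : (W.baseChange K).geomPrimaryTorsion 2) = y' from congrArg Subtype.val (he'₁ ⟨y', hy'⟩)]
  have hunit : IsUnit (r - (1 - r)) := (CMPrimes.two_dvd_or_two_dvd_one_sub_of_root hr).2
  obtain ⟨N₁, N₂, w, hN₁, hN₂, hw⟩ := exists_proj_levelData (p := 2) (r := r) (r' := 1 - r) hunit N
  obtain ⟨Q₁, hQ₁⟩ := exists_toGeomPoints_eq_endRing_apply (W.baseChange K) π Q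
  have hS := resH1Hom_subtype_proj_kummerMapLevel (W.baseChange K) 2 π r (1 - r) e e' he hsum hN₁ hN₂ hw Q Q₁ hQ₁
  exact resOfLe_levelLift_kummerMapTorsion_eq_zero_of_comap_le (W.baseChange K) 2 π r N e he v
    (CMPrimes.hH1_holds d hd0 hsq hd4 W C hC hrk K hK v vbar hv hvbar hne π hrel r hr hpinI P c₀ ℓ hP hgen hc₀ hker hlog hfin)
    Q ⟨_, hS⟩

end Frame

end Summit.BirchSwinnertonDyer.BirchSwinnertonDyer.Theorems.PrintCf2.SelmerLocImage

end
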